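import Mathlib
import Literature.Combinatorics.Optimization.DnPermutahedronEF
import HarnessLib

/-!
# Lower bounds for the `B_n`- and `D_n`-permutahedra of a point: `xc ≥ log₂(2ⁿ·n!)` resp.
# `≥ log₂(2^{n−1}·n!)` by Goemans' face counting (complements Kaibel–Pashkovich 2011, Theorems 5–6) — PROVED

Sources. M. Goemans, *Smallest compact formulation for the permutahedron*, Math. Programming 153
(2015) [Goemans2015], Theorem 1 (§2): "any extended formulation of a polytope `P` with `v(P)` vertices
(or more generally faces) needs at least `log₂ v(P)` inequalities" — in the tree as
`HasEFOfSize.natCard_extremePoints_le` (`ExtendedFormulationFaceCounting.lean`). V. Kaibel,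
K. Pashkovich, *Constructing extended formulations from reflection relations*, IPCO 2011
[KaibelPashkovich2011] (held text `paper:arxiv-1011.3597`), §4.1.3 (arXiv p. 10): "the convex hull of
all points which can be obtained from `x` by permuting its coordinates and changing the signs of some
subset of its coordinates" (the `B_n`-orbit polytope, `signPermHull`; Theorem 5: an EF of size
`O(n log n)`), §4.1.4 (arXiv p. 11): "… changing the signs of an even number of its coordinates" (the
`D_n`-orbit polytope, `dnHull`; Theorem 6).

## What is proved (no named fact)

* `mem_extremePoints_convexHull_of_dotProduct_self_eq` — in a set of vectors of equal Euclidean norm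
  every member is an extreme point of the convex hull (it is the unique maximiser of `⟨x, ·⟩`);
* `signPerm_sortedVec_injective` — the `2ⁿ·n!` signed permutations of `(1, 2, …, n)` are pairwise
  distinct; `dotProduct_self_signPerm` — and all have the same norm;
* **`KaibelPashkovich2011_thm5_lower`** : `HasEFOfSize (signPermHull {(1,…,n)}) r → 2ⁿ·n! ≤ 2^r`, i.e.
  `xc(Π_{B_n}((1,…,n))) ≥ n + log₂ n!` — matching Theorem 5's `O(n log n)` up to the constant
  (`KaibelPashkovich2011_thm5_point`: `≤ 2n(⌈log₂ n⌉² + 4) + 2n` in the tree);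
* **`KaibelPashkovich2011_thm6_lower`** : `HasEFOfSize (dnHull {(1,…,n)}) r → 2^{n−1}·n! ≤ 2^r`
  (`n ≥ 1`; the even sign patterns are counted through the injection "fix the parity with the last
  coordinate", `DnFix.toDnIndex_injective`).

Honest framing: Literature infrastructure on extended formulations (Goemans' counting bound applied to
the Kaibel–Pashkovich orbit polytopes); nothing here bears on `P ≠ NP`.
-/

noncomputable section

namespace Literature.Combinatorics.Optimization

open Finset Literature.Barriers.PneNP

variable {n : ℕ}

/-! ### Equal norms ⇒ extreme points -/

/-- In a set `S` of vectors all of the same Euclidean norm, every member is an extreme point of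
`conv S`: `⟨x, q⟩ < ⟨x, x⟩` for `q ≠ x` since `0 < ‖x − q‖² = 2⟨x,x⟩ − 2⟨x,q⟩`.
[cite: Goemans2015, Thm. 1 (§2)] -/
theorem mem_extremePoints_convexHull_of_dotProduct_self_eq {ι : Type} [Fintype ι] {S : Set (ι → ℝ)}
    {c : ℝ} (hS : ∀ y ∈ S, y ⬝ᵥ y = c) {x : ι → ℝ} (hx : x ∈ S) :
    x ∈ (convexHull ℝ S).extremePoints ℝ := by
  refine mem_extremePoints_convexHull_of_dotProduct_lt (c := x) hx fun q hq hne => ?_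
  have hpos : 0 < (x - q) ⬝ᵥ (x - q) := by
    have h0 : 0 ≤ (x - q) ⬝ᵥ (x - q) := Finset.sum_nonneg fun i _ => mul_self_nonneg _
    rcases h0.lt_or_eq with h | h
    · exact h
    · exact absurd (sub_eq_zero.1 (dotProduct_self_eq_zero.1 h.symm)) (Ne.symm hne)
  have hexp : (x - q) ⬝ᵥ (x - q) = x ⬝ᵥ x - 2 * (x ⬝ᵥ q) + q ⬝ᵥ q := by
    simp only [sub_dotProduct, dotProduct_sub, dotProduct_comm q x]; ring
  rw [hexp, hS x hx, hS q hq] at hpos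
  rw [hS x hx]
  linarith

/-! ### The signed permutations of `(1, …, n)` -/

/-- `γ.ε.(1,…,n)`: the signed permutation `flipSigns S (1,…,n) ∘ σ`. [cite: KaibelPashkovich2011, §4.1.3 (arXiv p. 10)] -/
def signPermVec (p : Equiv.Perm (Fin n) × Finset (Fin n)) : Fin n → ℝ :=
  flipSigns p.2 (ComparatorNetwork.sortedVec n) ∘ ⇑p.1

/-- Coordinates of a signed permutation of `(1,…,n)`. [cite: KaibelPashkovich2011, §4.1.3 (arXiv p. 10)] -/
theorem signPermVec_apply (p : Equiv.Perm (Fin n) × Finset (Fin n)) (i : Fin n) :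
    signPermVec p i = (if p.1 i ∈ p.2 then -1 else 1) * (((p.1 i : ℕ) : ℝ) + 1) := rfl

/-- `|γ.ε.(1,…,n)_i| = σ(i) + 1`. [cite: KaibelPashkovich2011, §4.1.3 (arXiv p. 10)] -/
theorem abs_signPermVec_apply (p : Equiv.Perm (Fin n) × Finset (Fin n)) (i : Fin n) :
    |signPermVec p i| = ((p.1 i : ℕ) : ℝ) + 1 := by
  rw [signPermVec_apply, abs_mul, abs_of_pos (by positivity : (0 : ℝ) < ((p.1 i : ℕ) : ℝ) + 1)]
  split_ifs <;> simp

/-- All signed permutations of `(1,…,n)` have the same norm `Σ_i (i+1)²`.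
[cite: Goemans2015, Thm. 1 (§2)] -/
theorem dotProduct_self_signPermVec (p : Equiv.Perm (Fin n) × Finset (Fin n)) :
    signPermVec p ⬝ᵥ signPermVec p = ∑ i : Fin n, (((i : ℕ) : ℝ) + 1) ^ 2 := by
  unfold dotProduct
  have : ∀ i, signPermVec p i * signPermVec p i = (((p.1 i : ℕ) : ℝ) + 1) ^ 2 := by
    intro i
    rw [← abs_mul_abs_self, abs_signPermVec_apply]; ring
  simp_rw [this]
  exact Fintype.sum_equiv p.1 (fun i => (((p.1 i : ℕ) : ℝ) + 1) ^ 2) (fun i => (((i : ℕ) : ℝ) + 1) ^ 2)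
    fun i => rfl

/-- The `2ⁿ·n!` signed permutations of `(1,…,n)` are pairwise distinct (the entries `1, …, n` are
distinct and nonzero). [cite: KaibelPashkovich2011, §4.1.3 (arXiv p. 10)] -/
theorem signPermVec_injective : Function.Injective (signPermVec (n := n)) := by
  rintro ⟨σ, S⟩ ⟨σ', S'⟩ h
  have hσ : σ = σ' := by
    ext i
    have := congrArg (fun v => |v i|) h
    simp only [abs_signPermVec_apply] at this
    exact_mod_cast (add_right_cancel this : ((σ i : ℕ) : ℝ) = ((σ' i : ℕ) : ℝ))
  subst hσ
  have hS : S = S' := by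
    ext j
    have := congrFun h (σ.symm j)
    simp only [signPermVec_apply, Equiv.apply_symm_apply] at this
    have hpos : (0 : ℝ) < ((j : ℕ) : ℝ) + 1 := by positivity
    have hsign : (if j ∈ S then (-1 : ℝ) else 1) = (if j ∈ S' then (-1 : ℝ) else 1) :=
      mul_right_cancel₀ hpos.ne' this
    by_cases h1 : j ∈ S <;> by_cases h2 : j ∈ S' <;> simp [h1, h2] at hsign ⊢ <;> norm_num at hsign
  rw [hS]

/-- `Π_{B_n}((1,…,n))` is the convex hull of the signed permutations of `(1,…,n)`.
[cite: KaibelPashkovich2011, §4.1.3 (arXiv p. 10)] -/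
theorem signPermHull_singleton_eq :
    signPermHull ({ComparatorNetwork.sortedVec n} : Set (Fin n → ℝ)) = convexHull ℝ (Set.range (signPermVec (n := n))) := by
  rw [signPermHull]
  congr 1
  ext x
  simp only [Set.mem_iUnion, Set.image_singleton, Set.mem_singleton_iff, Set.mem_range]
  constructor
  · rintro ⟨p, rfl⟩; exact ⟨p, rfl⟩
  · rintro ⟨p, rfl⟩; exact ⟨p, rfl⟩

/-- **Lower bound for Theorem 5's polytope**: every extended formulation of the `B_n`-permutahedron of
`(1,…,n)` (all `2ⁿ·n!` signed permutations are vertices) has at least `log₂(2ⁿ·n!) = n + log₂ n!`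
inequalities: `2ⁿ·n! ≤ 2^r`. [cite: Goemans2015, Thm. 1 (§2)][cite: KaibelPashkovich2011, Thm. 5 (arXiv p. 10)] -/
theorem KaibelPashkovich2011_thm5_lower {r : ℕ}
    (h : HasEFOfSize (signPermHull ({ComparatorNetwork.sortedVec n} : Set (Fin n → ℝ))) r) :
    2 ^ n * Nat.factorial n ≤ 2 ^ r := by
  classical
  rw [signPermHull_singleton_eq] at h
  set S : Set (Fin n → ℝ) := Set.range (signPermVec (n := n))
  haveI : Finite ((convexHull ℝ S).extremePoints ℝ) := h.finite_extremePoints.to_subtype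
  have hnorm : ∀ y ∈ S, y ⬝ᵥ y = ∑ i : Fin n, (((i : ℕ) : ℝ) + 1) ^ 2 := by
    rintro _ ⟨p, rfl⟩; exact dotProduct_self_signPermVec p
  let f : Equiv.Perm (Fin n) × Finset (Fin n) → (convexHull ℝ S).extremePoints ℝ := fun p =>
    ⟨signPermVec p, mem_extremePoints_convexHull_of_dotProduct_self_eq hnorm ⟨p, rfl⟩⟩
  have hf : Function.Injective f := fun p p' hpp' => signPermVec_injective (congrArg Subtype.val hpp')
  calc 2 ^ n * Nat.factorial n = Nat.card (Equiv.Perm (Fin n) × Finset (Fin n)) := by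
        rw [Nat.card_eq_fintype_card, Fintype.card_prod, Fintype.card_perm, Fintype.card_finset,
          Fintype.card_fin, mul_comm]
    _ ≤ Nat.card ((convexHull ℝ S).extremePoints ℝ) := Nat.card_le_card_of_injective f hf
    _ ≤ 2 ^ r := h.natCard_extremePoints_le

/-! ### The `D_n` case: even sign patterns -/

namespace DnFix

variable {m : ℕ}

/-- Fix the parity with the last coordinate: `T ⊆ [m]` becomes the even set `T` or `T ∪ {m}` in
`[m+1]`. [cite: KaibelPashkovich2011, §4.1.4 (arXiv p. 11: "an even number of its coordinates")] -/
def evenSet (T : Finset (Fin m)) : Finset (Fin (m + 1)) :=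
  if Even T.card then T.map Fin.castSuccEmb else insert (Fin.last m) (T.map Fin.castSuccEmb)

/-- `evenSet T` has even cardinality. [cite: KaibelPashkovich2011, §4.1.4 (arXiv p. 11)] -/
theorem even_card_evenSet (T : Finset (Fin m)) : Even (evenSet T).card := by
  unfold evenSet
  split_ifs with h
  · rwa [Finset.card_map]
  · rw [Finset.card_insert_of_notMem, Finset.card_map]
    · exact Nat.even_add_one.2 h
    · simp only [Finset.mem_map, Fin.castSuccEmb_apply, not_exists, not_and]
      exact fun i _ => (Fin.castSucc_lt_last i).ne

/-- Recovering `T`: `castSucc i ∈ evenSet T ↔ i ∈ T`. [cite: KaibelPashkovich2011, §4.1.4 (arXiv p. 11)] -/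
theorem castSucc_mem_evenSet (T : Finset (Fin m)) (i : Fin m) : Fin.castSucc i ∈ evenSet T ↔ i ∈ T := by
  unfold evenSet
  split_ifs
  · simp [Finset.mem_map]
  · simp [Finset.mem_map, (Fin.castSucc_lt_last i).ne]

/-- `T ↦ evenSet T` is injective. [cite: KaibelPashkovich2011, §4.1.4 (arXiv p. 11)] -/
theorem evenSet_injective : Function.Injective (evenSet (m := m)) := by
  intro T T' h
  ext i
  rw [← castSucc_mem_evenSet T i, ← castSucc_mem_evenSet T' i, h]

/-- The injection `𝔖(m+1) × 2^{[m]} ↪ D_{m+1}`-indices. [cite: KaibelPashkovich2011, §4.1.4 (arXiv p. 11)] -/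
def toDnIndex (p : Equiv.Perm (Fin (m + 1)) × Finset (Fin m)) : DnIndex (m + 1) :=
  ⟨(p.1, evenSet p.2), even_card_evenSet p.2⟩

/-- `toDnIndex` is injective. [cite: KaibelPashkovich2011, §4.1.4 (arXiv p. 11)] -/
theorem toDnIndex_injective : Function.Injective (toDnIndex (m := m)) := by
  rintro ⟨σ, T⟩ ⟨σ', T'⟩ h
  have h' := congrArg Subtype.val h
  simp only [toDnIndex, Prod.mk.injEq] at h'
  rw [h'.1, evenSet_injective h'.2]

end DnFix

/-- `Π_{D_n}((1,…,n))` is the convex hull of the evenly-signed permutations of `(1,…,n)`.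
[cite: KaibelPashkovich2011, §4.1.4 (arXiv p. 11)] -/
theorem dnHull_singleton_eq :
    dnHull ({ComparatorNetwork.sortedVec n} : Set (Fin n → ℝ)) =
      convexHull ℝ (Set.range fun p : DnIndex n => signPermVec p.1) := by
  rw [dnHull, dnOrbit]
  congr 1
  ext x
  simp only [Set.mem_iUnion, Set.image_singleton, Set.mem_singleton_iff, Set.mem_range]
  constructor
  · rintro ⟨p, rfl⟩; exact ⟨p, rfl⟩
  · rintro ⟨p, rfl⟩; exact ⟨p, rfl⟩

/-- **Lower bound for Theorem 6's polytope**: every extended formulation of the `D_n`-permutahedron of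
`(1,…,n)` (`n = m + 1`; its `2^{n−1}·n!` evenly-signed permutations are vertices) has at least
`log₂(2^{n−1}·n!)` inequalities: `2^{n−1}·n! ≤ 2^r`. [cite: Goemans2015, Thm. 1 (§2)][cite: KaibelPashkovich2011, Thm. 6 (arXiv p. 11)] -/
theorem KaibelPashkovich2011_thm6_lower {m r : ℕ}
    (h : HasEFOfSize (dnHull ({ComparatorNetwork.sortedVec (m + 1)} : Set (Fin (m + 1) → ℝ))) r) :
    2 ^ m * Nat.factorial (m + 1) ≤ 2 ^ r := by
  classical
  rw [dnHull_singleton_eq] at h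
  set S : Set (Fin (m + 1) → ℝ) := Set.range fun p : DnIndex (m + 1) => signPermVec p.1
  haveI : Finite ((convexHull ℝ S).extremePoints ℝ) := h.finite_extremePoints.to_subtype
  have hnorm : ∀ y ∈ S, y ⬝ᵥ y = ∑ i : Fin (m + 1), (((i : ℕ) : ℝ) + 1) ^ 2 := by
    rintro _ ⟨p, rfl⟩; exact dotProduct_self_signPermVec p.1
  let f : Equiv.Perm (Fin (m + 1)) × Finset (Fin m) → (convexHull ℝ S).extremePoints ℝ := fun p =>
    ⟨signPermVec (DnFix.toDnIndex p).1,
      mem_extremePoints_convexHull_of_dotProduct_self_eq hnorm ⟨DnFix.toDnIndex p, rfl⟩⟩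
  have hf : Function.Injective f := fun p p' hpp' => by
    have h1 : signPermVec (DnFix.toDnIndex p).1 = signPermVec (DnFix.toDnIndex p').1 :=
      congrArg Subtype.val hpp'
    exact DnFix.toDnIndex_injective (Subtype.ext (signPermVec_injective h1))
  calc 2 ^ m * Nat.factorial (m + 1) = Nat.card (Equiv.Perm (Fin (m + 1)) × Finset (Fin m)) := by
        rw [Nat.card_eq_fintype_card, Fintype.card_prod, Fintype.card_perm, Fintype.card_finset,
          Fintype.card_fin, Fintype.card_fin, mul_comm]
    _ ≤ Nat.card ((convexHull ℝ S).extremePoints ℝ) := Nat.card_le_card_of_injective f hf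
    _ ≤ 2 ^ r := h.natCard_extremePoints_le

end Literature.Combinatorics.Optimization

end
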